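import Summits.ResolutionOfSingularities.ResolutionOfSingularities.Theses.DeepSandwich
import Summits.ResolutionOfSingularities.ResolutionOfSingularities.Theorems.DeepSandwichRadialCore
import Summits.ResolutionOfSingularities.ResolutionOfSingularities.Theorems.PunctualFirstTransform
import Summits.ResolutionOfSingularities.ResolutionOfSingularities.Theorems.MaxContactCutExhaustion
import HarnessLib

/-!
# DeepSandwichFirstTransform — by-name kernels of the decomp-res node «FirstTransform» (phase 3 of the filing)

Cell decomp-res, lens-4 g5 node FirstTransform (CRITIC-LEDGER row 36, CLEARED AS CHILD NODE of `DeepSandwich` on its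
punctual hub `DeepSandwich.AffinePunctualResolve`, item stmt-28257).  Phase 1 = `Theorems/PunctualFirstTransform.lean`
(definitions and n-sliced pieces, p763076); phase 2 = the five ASIDES on route DeepSandwich (rev 6, commit f8f6ef01e2f1):
`OrderOnePunctualResolve` (stmt-28845, O1), `OrderTwoPunctualResolve` (stmt-28846, O2 = declared located residual),
`SmoothConePunctualResolve` (stmt-28847, SCR), `SmoothConePunctualResolveLowDim` (stmt-28848, SCR≤4, KNOWN-MOD-PORT),
`ConeTransfer` (stmt-28849, THEOREM A, NEW LEMMA = prover target #3).  THIS FILE proves, against those decls BY NAME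
(all 0 sorry; proofs verbatim from HOME/decomp-res-lens-4/g5/FirstTransform.lean sha256 6b39ab25…, the critic's own
`lean check` rc 0):

* `affinePunctualResolve_iff_slices` — APR ⟺ ∀ n, `AffinePunctualResolveAt n`;
* `affinePunctualResolve_iff` — **EXACT BISECTION** APR ⟺ O1 ∧ O2 (excluded middle on the datum μ₁ ≤ 1);
* `closes` — O1 → O2 → APR (the node decides its target by name); necessity `orderOnePunctualResolve_of_apr`,
  `orderTwoPunctualResolve_of_apr`, `smoothConePunctualResolve_of_apr`, `smoothConePunctualResolveLowDim_of`;
* `pieces_of_summit` — ROOT ⟹ O1 ∧ O2 ∧ SCR ∧ SCR≤4 (via `DeepSandwich.affinePunctualResolve_of_summit`);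
* DEDUP BY NAME (critic row 36 / lens-4 g6 ANSWER): `markedPrincipalization_three_iff_markedThreefoldResolutionAt_one` —
  the port `PunctualFirstTransform.MarkedPrincipalization 3` IS lens-5's X1 at marking 1,
  `MaxContactCutExhaustion.MarkedThreefoldResolutionAt 1`, and `markedPrincipalization_three_of_item` reads it off the
  route aside `MaxContactCut.MarkedThreefoldResolution` (stmt-28616, all markings);
* `coneTransferDimFour_of`, `smoothConePunctualResolveLowDim_of_transfer` — **SCR≤4 ⟸ THEOREM A + X1@1** (the port
  in dimension n − 1 ≤ 3 follows from d = 3 by `PunctualFirstTransform.markedPrincipalization_mono`), and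
  `smoothConePunctualResolveLowDim_of_transfer_of_item` — the same from the MaxContactCut aside 28616;
* `affinePunctualResolveAt_four_iff_of` — LOCATION in the frontier dimension: given O1₄, APR₄ ⟺ the residual O2₄.

No new definitions.  Census data cited by the node: HOME/census/punct/T-torusfree-punct.md sha256 038fb35d… (instrument
T-mu1-punct endorsed by the critic, pending).  [CossartPiltant2019 Prop 4.3/4.4; Cutkosky2009 Thm 5.1 / Lemma 5.2;
Kollar2007 Thm 3.105; CossartJannsenSaito2020]
-/

open AlgebraicGeometry CategoryTheory Literature.AlgebraicGeometry.Resolution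
open Summit.ResolutionOfSingularities.ResolutionOfSingularities.Theses
open Summit.ResolutionOfSingularities.ResolutionOfSingularities.Theorems.PunctualFirstTransform

namespace Summit.ResolutionOfSingularities.ResolutionOfSingularities.Theorems.DeepSandwichFirstTransform

/-- APR ⟺ all its slices `AffinePunctualResolveAt n`. -/
theorem affinePunctualResolve_iff_slices :
    DeepSandwich.AffinePunctualResolve ↔ ∀ n : ℕ, AffinePunctualResolveAt n :=
  ⟨fun h n p hp k _ _ I hI hN => h p hp k n I hI hN, fun h p hp k _ _ n I hI hN => h n p hp k I hI hN⟩

/-- **EXACT BISECTION of the target**: `APR ⟺ O1 ∧ O2` (the asides `DeepSandwich.OrderOnePunctualResolve` and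
`DeepSandwich.OrderTwoPunctualResolve`, by name). -/
theorem affinePunctualResolve_iff :
    DeepSandwich.AffinePunctualResolve ↔
      DeepSandwich.OrderOnePunctualResolve ∧ DeepSandwich.OrderTwoPunctualResolve := by
  rw [affinePunctualResolve_iff_slices]
  constructor
  · intro h
    exact ⟨fun n => ((affinePunctualResolveAt_iff n).mp (h n)).1,
      fun n => ((affinePunctualResolveAt_iff n).mp (h n)).2⟩
  · rintro ⟨h1, h2⟩ n
    exact (affinePunctualResolveAt_iff n).mpr ⟨h1 n, h2 n⟩

/-- **`closes`** — the node decides its target: O1 → O2 → `DeepSandwich.AffinePunctualResolve` (VERBATIM decl). -/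
theorem closes (h1 : DeepSandwich.OrderOnePunctualResolve) (h2 : DeepSandwich.OrderTwoPunctualResolve) :
    DeepSandwich.AffinePunctualResolve :=
  affinePunctualResolve_iff.mpr ⟨h1, h2⟩

/-- NECESSITY of O1 from the target. -/
theorem orderOnePunctualResolve_of_apr (h : DeepSandwich.AffinePunctualResolve) :
    DeepSandwich.OrderOnePunctualResolve :=
  (affinePunctualResolve_iff.mp h).1

/-- NECESSITY of O2 from the target. -/
theorem orderTwoPunctualResolve_of_apr (h : DeepSandwich.AffinePunctualResolve) :
    DeepSandwich.OrderTwoPunctualResolve :=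
  (affinePunctualResolve_iff.mp h).2

/-- NECESSITY of SCR from the target (the rung forgets its hypothesis). -/
theorem smoothConePunctualResolve_of_apr (h : DeepSandwich.AffinePunctualResolve) :
    DeepSandwich.SmoothConePunctualResolve :=
  fun n p hp k _ _ I hI hN _ => h p hp k n I hI hN

/-- SCR ⟹ SCR≤4 (slice). -/
theorem smoothConePunctualResolveLowDim_of (h : DeepSandwich.SmoothConePunctualResolve) :
    DeepSandwich.SmoothConePunctualResolveLowDim :=
  fun n _ _ => h n

/-- NECESSITY from ROOT: O1, O2, SCR, SCR≤4 (via the tree kernel `DeepSandwich.affinePunctualResolve_of_summit`). -/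
theorem pieces_of_summit (h : _root_.ResolutionOfSingularities) :
    DeepSandwich.OrderOnePunctualResolve ∧ DeepSandwich.OrderTwoPunctualResolve ∧
      DeepSandwich.SmoothConePunctualResolve ∧ DeepSandwich.SmoothConePunctualResolveLowDim :=
  have hA := DeepSandwich.affinePunctualResolve_of_summit h
  ⟨orderOnePunctualResolve_of_apr hA, orderTwoPunctualResolve_of_apr hA, smoothConePunctualResolve_of_apr hA,
    smoothConePunctualResolveLowDim_of (smoothConePunctualResolve_of_apr hA)⟩

/-- **DEDUP BY NAME** (critic row 36): the port `MarkedPrincipalization 3` of this node is lens-5's X1 at marking 1,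
`MaxContactCutExhaustion.MarkedThreefoldResolutionAt 1` (same statement up to the cast `((3 : ℕ) : WithBot ℕ∞) = 3`). -/
theorem markedPrincipalization_three_iff_markedThreefoldResolutionAt_one :
    MarkedPrincipalization 3 ↔ MaxContactCutExhaustion.MarkedThreefoldResolutionAt 1 := by
  constructor
  · intro h p hp k _ _ S g hg1 hg2 hg3 hS hdim J hJ
    exact h p hp k S g hg1 hg2 hg3 hS (by exact_mod_cast hdim) J hJ
  · intro h p hp k _ _ S g hg1 hg2 hg3 hS hdim J hJ
    exact h p hp k S g hg1 hg2 hg3 hS (by exact_mod_cast hdim) J hJ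

/-- The route aside X1 `MaxContactCut.MarkedThreefoldResolution` (stmt-28616, all markings `c ≥ 1`) gives the port
`MarkedPrincipalization 3` (its marking-1 slice). -/
theorem markedPrincipalization_three_of_item (h : MaxContactCut.MarkedThreefoldResolution) :
    MarkedPrincipalization 3 :=
  markedPrincipalization_three_iff_markedThreefoldResolutionAt_one.mpr
    (MaxContactCutExhaustion.markedThreefoldResolutionAt_of_item h 1 le_rfl)

/-- `ConeTransfer` specialises to the frontier dimension: `MarkedPrincipalization 3 → SmoothConePunctualResolveAt 4`. -/
theorem coneTransferDimFour_of (h : DeepSandwich.ConeTransfer) :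
    MarkedPrincipalization 3 → SmoothConePunctualResolveAt 4 :=
  fun h3 => h 4 (by norm_num) h3

/-- **SCR≤4 ⟸ THEOREM A + X1@1**: with the transfer and the threefold port at marking 1, the smooth-cone rung holds
in every dimension `n ≤ 4` (the port in dimension `n - 1 ≤ 3` follows from the one in dimension 3 by monotonicity). -/
theorem smoothConePunctualResolveLowDim_of_transfer (hT : DeepSandwich.ConeTransfer)
    (h3 : MaxContactCutExhaustion.MarkedThreefoldResolutionAt 1) :
    DeepSandwich.SmoothConePunctualResolveLowDim := by
  have h3' : MarkedPrincipalization 3 :=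
    markedPrincipalization_three_iff_markedThreefoldResolutionAt_one.mpr h3
  intro n hn1 hn4
  exact hT n hn1 (markedPrincipalization_mono (by omega) h3')

/-- SCR≤4 from THEOREM A and the route aside X1 (stmt-28616). -/
theorem smoothConePunctualResolveLowDim_of_transfer_of_item (hT : DeepSandwich.ConeTransfer)
    (hX1 : MaxContactCut.MarkedThreefoldResolution) : DeepSandwich.SmoothConePunctualResolveLowDim :=
  smoothConePunctualResolveLowDim_of_transfer hT
    (MaxContactCutExhaustion.markedThreefoldResolutionAt_of_item hX1 1 le_rfl)

/-- LOCATION in the frontier dimension, from the all-`n` aside: given O1, APR₄ ⟺ the residual O2₄. -/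
theorem affinePunctualResolveAt_four_iff_of (h1 : DeepSandwich.OrderOnePunctualResolve) :
    AffinePunctualResolveAt 4 ↔ OrderTwoPunctualResolveAt 4 :=
  affinePunctualResolveAt_four_iff (h1 4)

end Summit.ResolutionOfSingularities.ResolutionOfSingularities.Theorems.DeepSandwichFirstTransform
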